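import Literature.Geometry.Lorentzian.EndFluxEstimates
import Literature.Geometry.Lorentzian.EndChartIntegral
import Literature.Geometry.Lorentzian.GreenIdentityCompactSupport
import HarnessLib

/-!
# The flux formula `∫_N Δ_h v dV_h = −4πA` for `v = c + A/r + O₁(r⁻²)` (Schoen–Yau 1979, (3.16))

Schoen–Yau, Comm. Math. Phys. 65 (1979), Lemma 3.2 (p. 64) with (3.16) (p. 68): the solution
of `Δv − fv = h` on the one-ended asymptotically flat manifold `N` has the expansion
`v = A/r + ω`, `ω = O₂(r⁻²)`, with **`A = −(1/4π) ∫_N (fv + h) √g dx`**, i.e.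
`∫_N Δv dV = −4πA`; for the conformal equation (3.23) of Lemma 3.3 this is the mass formula
`2A = −(1/16π) ∫_N R φ √g dx` of `φ⁴ ds²`, the hypothesis `A = −(1/32π) ∫_N R φ dV` of
`exists_conformal_negativeMass_of_massZero_of_ellipticCore` (`ConformalScalarFlatSign.lean`). This
file **proves** the flux formula for any `v ∈ C²(N)` with `Δ_h v ∈ L¹(dV_h)` and
`D(v ∘ Φ − (c + A/r)) = O(r⁻³)` in the chart of the end, on a one-ended `3`-manifold with
`h − δ = O(r^{−α})`, `α > 0`:

* `AFEnd.integral_dalembertian_eq_of_expansion` — `∫_X Δ_h v dV_h = −4πA`;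
* `AFEnd.integral_dalembertian_eq_of_expansion'` — the same with the expansion in the
  `iteratedFDeriv` form `∀ m ≤ 2, ‖D^m(v ∘ Φ − (c + A/r))‖ = O(r^{−2−m})` used by the reductions of
  Schoen–Yau's Cor. 3.1 in this tree.

Proof (no boundary integrals): with the radial cut-offs `χ_ρ = χ(‖coord‖/ρ)` of
`EndFluxCutoff.lean` (smooth, compactly supported, `→ 1`), Green's identity on the non-compact
manifold (`GreenIdentityCompactSupport.lean`) gives `∫ χ_ρ Δv dV = −∫ ⟨dχ_ρ, dv⟩_h dV`; the left
side tends to `∫ Δv dV` (dominated convergence), and the right side, read in the chart of the end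
(`EndChartIntegral.lean`: `∫_{far} g dV = ∫ g(Φ z) √(det h_{ij}) dz`,
`⟨dχ_ρ, dv⟩_h = (h_{ij})⁻¹ₖₗ ∂ₖV ∂ₗχ_ρ`), is `−∫ F_ρ dz` with
`F_ρ = ∑ W_{kl} ∂ₖV ∂ₗχ_ρ`, `W = (h_{ij})⁻¹ √(det h_{ij}) → δ` (`EndFluxEstimates.lean`): `F_ρ` is the
model integrand `χ'(r/ρ) ρ⁻¹ (−A/r²)`, whose integral is `4πA` exactly, plus an error bounded by
`(9η C_V C₁ + 3 C_ω C₁/ρ) ρ⁻³` on the annulus `ρ ≤ r ≤ 2ρ`, whose integral tends to `0`.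

## References

* R. Schoen, S.-T. Yau, *On the proof of the positive mass conjecture in general relativity*,
  Comm. Math. Phys. 65 (1979) 45–76, Lemma 3.2 and (3.16); Lemma 3.3 (mass of `φ⁴ ds²`).
* R. Bartnik, *The mass of an asymptotically flat manifold*, CPAM 39 (1986), §4 (flux integrals
  over large coordinate spheres).
-/

noncomputable section

open Set Function Filter Metric MeasureTheory Measure TopologicalSpace Bornology Asymptotics Manifold
  Bundle
open scoped Topology RealInnerProductSpace Matrix ENNReal Manifold ContDiff

namespace Literature.Geometry.Lorentzian

namespace AFEnd

variable {X : Type} [TopologicalSpace X] [ChartedSpace E3 X] [IsManifold (𝓡 3) ∞ X]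
  [T2Space X] [LocallyCompactSpace X] [SigmaCompactSpace X] [MeasurableSpace X] [BorelSpace X]
  (e : AFEnd X) (D : InitialDataSet (𝓡 3) X) [D.metric.HasLeviCivita]

/-! ### Auxiliary facts on the chart of the end -/

omit [T2Space X] [LocallyCompactSpace X] [SigmaCompactSpace X] [MeasurableSpace X] [BorelSpace X]
  [D.metric.HasLeviCivita] in
/-- The Gram matrix `h_{ij}(z)` of the end is invertible on the exterior region (it is the Gram
matrix of the nondegenerate pullback metric, `det_gram_ne_zero`). [folklore] -/
theorem det_gram_hCoeff_ne_zero {z : E3} (hz : e.R < ‖z‖) :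
    (Matrix.of fun i j ↦ hCoeff e D z (EuclideanSpace.single i 1) (EuclideanSpace.single j 1) :
      Matrix (Fin 3) (Fin 3) ℝ).det ≠ 0 := by
  set y : exteriorRegion e.R := ⟨z, mem_exteriorRegion.2 hz⟩ with hy
  set g' := D.metric.comap PseudoRiemannianMetric.contMDiff_pullbackBilin_holds e.dataChart
      e.contMDiff_dataChart_succ e.injective_mfderiv_dataChart rfl with hg'
  have h := det_gram_ne_zero g' y (EuclideanSpace.basisFun (Fin 3) ℝ).toBasis
  have hb : ∀ i, (EuclideanSpace.basisFun (Fin 3) ℝ).toBasis i = EuclideanSpace.single i 1 := fun i ↦ by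
    rw [OrthonormalBasis.coe_toBasis, EuclideanSpace.basisFun_apply]
  have hval : g'.val y = hCoeff e D z := e.val_comap_dataChart D y
  have hM : (Matrix.of fun i j ↦ hCoeff e D z (EuclideanSpace.single i 1) (EuclideanSpace.single j 1) :
      Matrix (Fin 3) (Fin 3) ℝ) =
      Matrix.of fun i j ↦ g'.val y ((EuclideanSpace.basisFun (Fin 3) ℝ).toBasis i)
        ((EuclideanSpace.basisFun (Fin 3) ℝ).toBasis j) := by
    ext i j
    simp only [Matrix.of_apply, hval, hb]
    rfl
  rw [hM]
  exact h

omit [T2Space X] [LocallyCompactSpace X] [SigmaCompactSpace X] [MeasurableSpace X] [BorelSpace X]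
  [D.metric.HasLeviCivita] in
/-- The entries of `(h_{ij})⁻¹` are continuous on the exterior region. [folklore] -/
theorem continuousOn_gram_hCoeff_inv (k l : Fin 3) :
    ContinuousOn (fun z : E3 ↦ (Matrix.of fun i j ↦ hCoeff e D z (EuclideanSpace.single i 1)
      (EuclideanSpace.single j 1) : Matrix (Fin 3) (Fin 3) ℝ)⁻¹ k l) {z | e.R < ‖z‖} := by
  intro z hz
  have hH : ContinuousAt (fun z : E3 ↦ (Matrix.of fun i j ↦ hCoeff e D z (EuclideanSpace.single i 1)
      (EuclideanSpace.single j 1) : Matrix (Fin 3) (Fin 3) ℝ)) z := by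
    refine continuousAt_pi.2 fun i ↦ continuousAt_pi.2 fun j ↦ ?_
    exact ((ContinuousLinearMap.apply ℝ ℝ (EuclideanSpace.single j 1)).continuous.comp
      (ContinuousLinearMap.apply ℝ (E3 →L[ℝ] ℝ) (EuclideanSpace.single i 1)).continuous).continuousAt
      |>.comp (e.contDiffAt_hCoeff D hz).continuousAt
  have hinv : ContinuousAt (Inv.inv : Matrix (Fin 3) (Fin 3) ℝ → Matrix (Fin 3) (Fin 3) ℝ)
      (Matrix.of fun i j ↦ hCoeff e D z (EuclideanSpace.single i 1) (EuclideanSpace.single j 1)) := by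
    refine continuousAt_matrix_inv _ ?_
    have : (Ring.inverse : ℝ → ℝ) = Inv.inv := Ring.inverse_eq_inv'
    rw [this]
    exact continuousAt_inv₀ (e.det_gram_hCoeff_ne_zero D hz)
  have hcomp : ContinuousAt (fun z : E3 ↦ (Matrix.of fun i j ↦ hCoeff e D z (EuclideanSpace.single i 1)
      (EuclideanSpace.single j 1) : Matrix (Fin 3) (Fin 3) ℝ)⁻¹) z :=
    ContinuousAt.comp (f := fun z : E3 ↦ (Matrix.of fun i j ↦ hCoeff e D z (EuclideanSpace.single i 1)
      (EuclideanSpace.single j 1) : Matrix (Fin 3) (Fin 3) ℝ)) (g := Inv.inv) hinv hH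
  exact (((continuous_apply l).comp (continuous_apply k)).continuousAt.comp hcomp).continuousWithinAt

omit [IsManifold (𝓡 3) ∞ X] [T2Space X] [LocallyCompactSpace X] [SigmaCompactSpace X]
  [MeasurableSpace X] [BorelSpace X] in
/-- A `C^n` function on `X` is `C^n` in the chart of the end (the `C^∞` case is
`contDiffOn_endValue`, `ConformalScalarFlat.lean`). [folklore] -/
theorem contDiffOn_endValue_of_contMDiff {n : ℕ} {f : X → ℝ} (hf : ContMDiff (𝓡 3) 𝓘(ℝ) n f) :
    ContDiffOn ℝ n (endValue e f) {x | e.R < ‖x‖} := by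
  intro x hx
  have h1 : ContMDiff (𝓡 3) 𝓘(ℝ) n (fun y : exteriorRegion e.R ↦ endValue e f (y : E3)) := by
    have : (fun y : exteriorRegion e.R ↦ endValue e f (y : E3)) = f ∘ e.dataChart := by
      funext y
      exact endValue_of_lt e f y.2
    rw [this]
    exact hf.comp (e.contMDiff_dataChart.of_le (by exact_mod_cast le_top))
  have h2 : ContMDiffAt 𝓘(ℝ, E3) 𝓘(ℝ) n (endValue e f) x :=
    (contMDiffAt_subtype_iff (U := exteriorRegion e.R) (x := ⟨x, hx⟩)).1 (h1 ⟨x, hx⟩)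
  exact (contMDiffAt_iff_contDiffAt.1 h2).contDiffWithinAt

/-! ### The flux formula -/
set_option maxHeartbeats 400000 in -- buildfix (bf3-g26): 160k/180k FAIL, 200k PASS at accept time; line-neutral budget line
/-- **`∫_N Δ_h v dV_h = −4πA` for `v = c + A/r + O₁(r⁻²)`** (the content of the mass formula
(3.16) of Schoen–Yau 1979, Lemma 3.2: `A = −(1/4π) ∫_N Δv`). Let `(X, h)` be a `3`-manifold
with an end `e` on which `h − δ = O₂(r^{−α})`, `α > 0` (`IsMetricAsymptoticallyFlat`), the only
end of `X`; let `v ∈ C²(X)` have integrable Laplacian `Δ_h v` and satisfy, in the chart of the end,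
`‖D(v ∘ Φ − (c + A/r))(z)‖ = O(‖z‖⁻³)`. Then `∫_X Δ_h v dV_h = −4πA`. Proof in the module
docstring: Green's identity against the radial cut-offs `χ_ρ`, dominated convergence, the chart
formula for the flux integrand and the model flux `∫ χ'(r/ρ) ρ⁻¹ (−A/r²) dz = 4πA`.
[cite: SchoenYauPMT1979, Lemma 3.2 (3.16)] -/
theorem integral_dalembertian_eq_of_expansion {α : ℝ} (hα : 0 < α)
    (hAF : e.IsMetricAsymptoticallyFlat D α) (hsole : e.IsSoleEnd) {v : X → ℝ}
    (hv : ContMDiff (𝓡 3) 𝓘(ℝ, ℝ) 2 v)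
    (hΔ : Integrable (D.metric.dalembertian v) (riemannianMeasure D.h)) {c A : ℝ}
    (hexp : (fun x : E3 ↦ ‖fderiv ℝ (fun y ↦ endValue e v y - (c + A / ‖y‖)) x‖) =O[cobounded E3]
      fun x ↦ ‖x‖ ^ (-3 : ℝ)) :
    ∫ x, D.metric.dalembertian v x ∂riemannianMeasure D.h = -(4 * Real.pi * A) := by
  classical
  haveI : (PseudoRiemannianMetric.ofRiemannian D.h).HasLeviCivita := ‹D.metric.HasLeviCivita›
  set μ : Measure X := riemannianMeasure D.h with hμ
  set L : ℝ := ∫ x, D.metric.dalembertian v x ∂μ with hL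
  -- notation in the chart: `H`, its inverse, the density, `V = v ∘ Φ`, the model `V⁰`
  set H : E3 → Matrix (Fin 3) (Fin 3) ℝ := fun z ↦ Matrix.of fun i j ↦
    hCoeff e D z (EuclideanSpace.single i 1) (EuclideanSpace.single j 1) with hHdef
  set dens : E3 → ℝ := fun z ↦ Real.sqrt (H z).det with hdens
  set V : E3 → ℝ := endValue e v with hVdef
  set V₀ : E3 → ℝ := fun y ↦ c + A / ‖y‖ with hV₀
  -- (0) the profile and its constants
  obtain ⟨χ, hχ, h1, h2, hχb⟩ := exists_radialProfile
  obtain ⟨C₁, hC₁, hdχ⟩ := exists_bound_deriv_radialProfile hχ h1 h2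
  -- (1) the constant and radius of the expansion
  obtain ⟨Cω', hCω'0, hCω'⟩ := hexp.exists_nonneg
  set Cω : ℝ := Cω' with hCωdef
  obtain ⟨R₂', -, hR₂'⟩ := (hasBasis_cobounded_norm (E := E3)).eventually_iff.1 hCω'.bound
  set R₂ : ℝ := max (max R₂' 1) (e.R + 1) with hR₂
  have hR₂1 : 1 ≤ R₂ := (le_max_right _ _).trans (le_max_left _ _)
  have hRR₂ : e.R < R₂ := by
    have : e.R + 1 ≤ R₂ := le_max_right _ _
    linarith
  have hω : ∀ z : E3, R₂ ≤ ‖z‖ → ‖fderiv ℝ (fun y ↦ V y - V₀ y) z‖ ≤ Cω / ‖z‖ ^ 3 := by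
    intro z hz
    have hz1 : 1 ≤ ‖z‖ := hR₂1.trans hz
    have hzR : R₂' ≤ ‖z‖ := ((le_max_left _ _).trans (le_max_left _ _)).trans hz
    have h := hR₂' (show z ∈ {x | R₂' ≤ ‖x‖} from hzR)
    simp only [norm_norm] at h
    rw [Real.norm_of_nonneg (Real.rpow_nonneg (norm_nonneg _) _), Real.rpow_neg (norm_nonneg _),
      show ((3 : ℝ)) = ((3 : ℕ) : ℝ) by norm_num, Real.rpow_natCast] at h
    rw [div_eq_mul_inv]
    exact h
  set CV : ℝ := |A| + Cω with hCVdef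
  have hCV0 : 0 ≤ CV := by positivity
  -- (2) derivatives of `V` in the chart: `|∂ₖV| ≤ C_V/r²`, `|∂ₖV − g⁰ₖ| ≤ C_ω/r³`
  have hVd : ∀ z : E3, e.R < ‖z‖ → DifferentiableAt ℝ V z := fun z hz ↦
    e.differentiableAt_endValue ⟨z, hz⟩ ((hv _).mdifferentiableAt (by simp))
  have hgrad : ∀ z : E3, R₂ ≤ ‖z‖ → ∀ k : Fin 3,
      |fderiv ℝ V z (EuclideanSpace.single k 1) - (-A * z k / ‖z‖ ^ 3)| ≤ Cω / ‖z‖ ^ 3 ∧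
      |fderiv ℝ V z (EuclideanSpace.single k 1)| ≤ CV / ‖z‖ ^ 2 := by
    intro z hz k
    have hz0 : z ≠ 0 := by
      rintro rfl
      simp at hz
      linarith
    have hzn : 0 < ‖z‖ := norm_pos_iff.2 hz0
    have hz1 : 1 ≤ ‖z‖ := hR₂1.trans hz
    have hzR : e.R < ‖z‖ := hRR₂.trans_le hz
    have hV₀d : DifferentiableAt ℝ V₀ z :=
      (((hasFDerivAt_inv_norm hz0).const_mul A).const_add c).differentiableAt.congr_of_eventuallyEq
        (Eventually.of_forall fun y ↦ by simp [hV₀, div_eq_mul_inv])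
    have hsub : fderiv ℝ (fun y ↦ V y - V₀ y) z = fderiv ℝ V z - fderiv ℝ V₀ z :=
      fderiv_sub (hVd z hzR) hV₀d
    have hg0 : fderiv ℝ V₀ z (EuclideanSpace.single k 1) = -A * z k / ‖z‖ ^ 3 :=
      fderiv_const_add_div_norm_apply c A hz0 k
    have hek : ‖(EuclideanSpace.single k (1 : ℝ) : E3)‖ = 1 := by simp
    have hdiff : |fderiv ℝ V z (EuclideanSpace.single k 1) - (-A * z k / ‖z‖ ^ 3)| ≤ Cω / ‖z‖ ^ 3 := by
      have heq : fderiv ℝ V z (EuclideanSpace.single k 1) - (-A * z k / ‖z‖ ^ 3) =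
          fderiv ℝ (fun y ↦ V y - V₀ y) z (EuclideanSpace.single k 1) := by
        rw [hsub, ← hg0]
        rfl
      rw [heq, ← Real.norm_eq_abs]
      calc ‖fderiv ℝ (fun y ↦ V y - V₀ y) z (EuclideanSpace.single k 1)‖
          ≤ ‖fderiv ℝ (fun y ↦ V y - V₀ y) z‖ * ‖(EuclideanSpace.single k (1 : ℝ) : E3)‖ :=
            ContinuousLinearMap.le_opNorm _ _
        _ ≤ Cω / ‖z‖ ^ 3 := by
            rw [hek, mul_one]
            exact hω z hz
    refine ⟨hdiff, ?_⟩
    have hmod := abs_modelGradient_le A hz0 k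
    have htri := abs_sub_abs_le_abs_sub (fderiv ℝ V z (EuclideanSpace.single k 1))
      (-A * z k / ‖z‖ ^ 3)
    have h3 : Cω / ‖z‖ ^ 3 ≤ Cω / ‖z‖ ^ 2 := by
      apply div_le_div_of_nonneg_left hCω'0 (by positivity)
      nlinarith
    calc |fderiv ℝ V z (EuclideanSpace.single k 1)|
        ≤ |(-A * z k / ‖z‖ ^ 3)| + Cω / ‖z‖ ^ 3 := by linarith
      _ ≤ |A| / ‖z‖ ^ 2 + Cω / ‖z‖ ^ 2 := add_le_add hmod h3
      _ = CV / ‖z‖ ^ 2 := by rw [hCVdef, add_div]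
  -- (3) Green's identity for the cut-offs `χ_ρ`, `ρ > R₂`
  have hΔc : Continuous (D.metric.dalembertian v) :=
    continuous_dalembertian (PseudoRiemannianMetric.ofRiemannian D.h) hv
  have hGreen : ∀ ρ : ℝ, R₂ < ρ →
      ∫ x, χ (‖e.coord x‖ / ρ) * D.metric.dalembertian v x ∂μ =
        -∫ x, D.metric.innerDual x (mvfderiv (𝓡 3) (fun q ↦ χ (‖e.coord q‖ / ρ)) x).toLinearMap
          (mvfderiv (𝓡 3) v x).toLinearMap ∂μ := by
    intro ρ hρ
    have hρR : e.R < ρ := hRR₂.trans hρ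
    have hρ0 : 0 < ρ := e.R_pos.trans hρR
    exact integral_mul_dalembertian_eq_neg_integral_innerDual_of_hasCompactSupport D.h
      ((e.contMDiff_radialCutoff hχ h1 hρR).of_le (by exact_mod_cast le_top))
      (e.hasCompactSupport_radialCutoff h2 hsole hρ0) hv
  -- (4) the left-hand side tends to `L` (dominated convergence)
  have hLHS : Tendsto (fun ρ : ℝ ↦ ∫ x, χ (‖e.coord x‖ / ρ) * D.metric.dalembertian v x ∂μ)
      atTop (𝓝 L) := by
    have hLmul : L = ∫ x, 1 * D.metric.dalembertian v x ∂μ := by simp [hL]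
    rw [hLmul]
    refine tendsto_integral_filter_of_dominated_convergence (fun x ↦ |D.metric.dalembertian v x|)
      ?_ ?_ hΔ.abs ?_
    · filter_upwards [eventually_gt_atTop e.R] with ρ hρ
      exact ((e.contMDiff_radialCutoff hχ h1 hρ).continuous.mul hΔc).aestronglyMeasurable
    · filter_upwards with ρ
      refine Eventually.of_forall fun x ↦ ?_
      rw [Real.norm_eq_abs, abs_mul]
      exact mul_le_of_le_one_left (abs_nonneg _) (hχb _)
    · refine Eventually.of_forall fun x ↦ ?_
      refine tendsto_const_nhds.congr' ?_
      filter_upwards [e.eventually_radialCutoff_eq_one h1 x] with ρ hρ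
      rw [hρ]
  -- (5) the right-hand side in the chart of the end
  -- the chart integrand `F_ρ` and the model integrand `M_ρ`
  set F : ℝ → E3 → ℝ := fun ρ z ↦ (∑ l, ∑ k, (H z)⁻¹ k l * fderiv ℝ V z (EuclideanSpace.single k 1) *
    fderiv ℝ (fun y : E3 ↦ χ (‖y‖ / ρ)) z (EuclideanSpace.single l 1)) * dens z with hFdef
  set M : ℝ → E3 → ℝ := fun ρ z ↦ deriv χ (‖z‖ / ρ) / ρ * (-A / ‖z‖ ^ 2) with hMdef
  have hRHS : ∀ ρ : ℝ, R₂ < ρ →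
      ∫ x, D.metric.innerDual x (mvfderiv (𝓡 3) (fun q ↦ χ (‖e.coord q‖ / ρ)) x).toLinearMap
          (mvfderiv (𝓡 3) v x).toLinearMap ∂μ = ∫ z in {z : E3 | R₂ < ‖z‖}, F ρ z := by
    intro ρ hρ
    have hρR : e.R < ρ := hRR₂.trans hρ
    -- the integrand is supported in `far R₂`
    have hsupp : support (fun x ↦ D.metric.innerDual x
        (mvfderiv (𝓡 3) (fun q ↦ χ (‖e.coord q‖ / ρ)) x).toLinearMap
        (mvfderiv (𝓡 3) v x).toLinearMap) ⊆ e.far R₂ := by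
      intro x hx
      rw [mem_support] at hx
      by_contra hfar
      apply hx
      rw [e.mvfderiv_radialCutoff_eq_zero h1 hρR (e.not_mem_closedFar_of_not_mem_far hρ hfar)]
      simp [PseudoRiemannianMetric.innerDual]
    rw [e.integral_eq_setIntegral_far D hRR₂.le hsupp]
    refine setIntegral_congr_fun (isOpen_lt continuous_const continuous_norm).measurableSet
      fun z hz ↦ ?_
    have hzR : e.R < ‖z‖ := hRR₂.trans hz
    rw [e.dataChartExt_of_lt hzR,
      e.innerDual_mvfderiv_dataChart D ⟨z, hzR⟩
        ((e.contMDiff_radialCutoff hχ h1 hρR _).mdifferentiableAt (by simp))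
        ((hv _).mdifferentiableAt (by simp))]
    -- the chart representative of `χ_ρ` near `z`
    have hev : endValue e (fun q ↦ χ (‖e.coord q‖ / ρ)) =ᶠ[𝓝 z] fun y : E3 ↦ χ (‖y‖ / ρ) := by
      filter_upwards [(isOpen_lt continuous_const continuous_norm).mem_nhds hzR] with y hy
      exact e.endValue_radialCutoff ρ hy
    simp only [hFdef, hHdef, hdens, hVdef, hev.fderiv_eq]
  -- (6) pointwise: `F_ρ = M_ρ` off the annulus, and the error bound on it
  have hF0 : ∀ ρ : ℝ, R₂ < ρ → ∀ z : E3, (‖z‖ < ρ ∨ 2 * ρ < ‖z‖) → F ρ z = 0 := by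
    intro ρ hρ z hz
    have hρ0 : 0 < ρ := by linarith
    simp [hFdef, fderiv_radialProfile_norm_div_eq_zero h1 h2 hρ0 hz]
  have hM0 : ∀ ρ : ℝ, R₂ < ρ → ∀ z : E3, (‖z‖ < ρ ∨ 2 * ρ < ‖z‖) → M ρ z = 0 := by
    intro ρ hρ z hz
    have hρ0 : 0 < ρ := by linarith
    simp only [hMdef]
    rcases hz with hz | hz
    · rw [deriv_radialProfile_eq_zero_of_lt_one h1 ((div_lt_one hρ0).2 hz)]
      simp
    · rw [deriv_radialProfile_eq_zero_of_two_lt h2 ((lt_div_iff₀ hρ0).2 (by linarith))]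
      simp
  have hErr : ∀ {η : ℝ}, 0 < η → ∀ {ρ₀ : ℝ}, (∀ z : E3, ρ₀ ≤ ‖z‖ → ∀ k l,
      |(H z)⁻¹ k l * dens z - (1 : Matrix (Fin 3) (Fin 3) ℝ) k l| ≤ η) →
      ∀ ρ : ℝ, R₂ < ρ → ρ₀ ≤ ρ → ∀ z : E3, R₂ < ‖z‖ →
        |F ρ z - M ρ z| ≤ (9 * η * CV * C₁ / ρ ^ 2 + 3 * Cω * C₁ / ρ ^ 3) / ρ := by
    intro η hη ρ₀ hW ρ hρ hρ₀ z hz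
    have hρ0 : 0 < ρ := by linarith
    have hρ1 : 1 ≤ ρ := hR₂1.trans hρ.le
    by_cases hann : ‖z‖ < ρ ∨ 2 * ρ < ‖z‖
    · rw [hF0 ρ hρ z hann, hM0 ρ hρ z hann, sub_zero, abs_zero]
      positivity
    push Not at hann
    obtain ⟨hzρ, hz2ρ⟩ := hann
    have hz0 : z ≠ 0 := by
      rintro rfl
      simp at hzρ
      linarith
    have hzn : 0 < ‖z‖ := norm_pos_iff.2 hz0
    -- rewrite both terms as sums over the same data
    have hFz : F ρ z = ∑ l, ∑ k, ((H z)⁻¹ k l * dens z) * fderiv ℝ V z (EuclideanSpace.single k 1) *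
        fderiv ℝ (fun y : E3 ↦ χ (‖y‖ / ρ)) z (EuclideanSpace.single l 1) := by
      simp only [hFdef, Finset.sum_mul]
      refine Finset.sum_congr rfl fun l _ ↦ Finset.sum_congr rfl fun k _ ↦ ?_
      ring
    have hMz : M ρ z = ∑ k, (-A * z k / ‖z‖ ^ 3) *
        fderiv ℝ (fun y : E3 ↦ χ (‖y‖ / ρ)) z (EuclideanSpace.single k 1) := by
      rw [sum_modelGradient_mul_fderiv_radialProfile hχ ρ A hz0]
    rw [hFz, hMz]
    have hkey := abs_fluxSum_sub_modelSum_le (W := Matrix.of fun k l ↦ (H z)⁻¹ k l * dens z)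
      (dV := fun k ↦ fderiv ℝ V z (EuclideanSpace.single k 1))
      (g := fun k ↦ -A * z k / ‖z‖ ^ 3)
      (dχ := fun l ↦ fderiv ℝ (fun y : E3 ↦ χ (‖y‖ / ρ)) z (EuclideanSpace.single l 1))
      hη.le hCV0 hCω'0 hzn
      (fun k l ↦ by simpa only [Matrix.of_apply] using hW z (hρ₀.trans hzρ) k l)
      (fun k ↦ (hgrad z hz.le k).2) (fun k ↦ (hgrad z hz.le k).1)
      (fun l ↦ by
        have h := (fderiv ℝ (fun y : E3 ↦ χ (‖y‖ / ρ)) z).le_opNorm (EuclideanSpace.single l 1)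
        have hel : ‖(EuclideanSpace.single l (1 : ℝ) : E3)‖ = 1 := by simp
        rw [hel, mul_one, Real.norm_eq_abs] at h
        exact h.trans (norm_fderiv_radialProfile_norm_div_le hχ h1 hC₁ hdχ hρ0 z))
    simp only [Matrix.of_apply] at hkey
    refine hkey.trans ?_
    -- `r ≥ ρ`: replace `r` by `ρ` in the bound
    have hA1 : 9 * η * CV * C₁ / ‖z‖ ^ 2 ≤ 9 * η * CV * C₁ / ρ ^ 2 :=
      div_le_div_of_nonneg_left (by positivity) (by positivity) (by nlinarith)
    have hA2 : 3 * Cω * C₁ / ‖z‖ ^ 3 ≤ 3 * Cω * C₁ / ρ ^ 3 :=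
      div_le_div_of_nonneg_left (by positivity) (by positivity)
        (pow_le_pow_left₀ hρ0.le hzρ 3)
    exact div_le_div_of_nonneg_right (add_le_add hA1 hA2) hρ0.le
  -- (7) continuity of `F_ρ` on the exterior region and of `M_ρ` everywhere; integrability
  have hVC2 : ContDiffOn ℝ 2 V {z | e.R < ‖z‖} := e.contDiffOn_endValue_of_contMDiff (n := 2) hv
  have hFc : ∀ ρ : ℝ, 0 < ρ → ContinuousOn (F ρ) {z | e.R < ‖z‖} := by
    intro ρ hρ
    have hopen : IsOpen {z : E3 | e.R < ‖z‖} := isOpen_lt continuous_const continuous_norm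
    have hdV : ∀ k, ContinuousOn (fun z ↦ fderiv ℝ V z (EuclideanSpace.single k 1)) {z | e.R < ‖z‖} :=
      fun k ↦ (hVC2.continuousOn_fderiv_of_isOpen hopen (by norm_num)).clm_apply continuousOn_const
    have hdχc : ∀ l, Continuous fun z ↦ fderiv ℝ (fun y : E3 ↦ χ (‖y‖ / ρ)) z (EuclideanSpace.single l 1) :=
      fun l ↦ ((contDiff_radialProfile_norm_div hχ h1 hρ).continuous_fderiv (by simp)).clm_apply
        continuous_const
    have hHc : ContinuousOn H {z | e.R < ‖z‖} := by
      refine continuousOn_pi.2 fun i ↦ continuousOn_pi.2 fun j ↦ ?_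
      exact ((ContinuousLinearMap.apply ℝ ℝ (EuclideanSpace.single j 1)).continuous.comp
        (ContinuousLinearMap.apply ℝ (E3 →L[ℝ] ℝ) (EuclideanSpace.single i 1)).continuous)
        |>.comp_continuousOn (e.continuousOn_hCoeff D)
    have hdensc : ContinuousOn dens {z | e.R < ‖z‖} :=
      Real.continuous_sqrt.comp_continuousOn (continuous_id.matrix_det.comp_continuousOn hHc)
    refine ContinuousOn.mul ?_ hdensc
    refine continuousOn_finsetSum _ fun l _ ↦ continuousOn_finsetSum _ fun k _ ↦ ?_
    exact ((e.continuousOn_gram_hCoeff_inv D k l).mul (hdV k)).mul (hdχc l).continuousOn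
  have hMc : ∀ ρ : ℝ, R₂ < ρ → Continuous (M ρ) := by
    intro ρ hρ
    have hρ0 : 0 < ρ := by linarith
    rw [continuous_iff_continuousAt]
    intro z
    by_cases hz : ‖z‖ < ρ
    · have hev : M ρ =ᶠ[𝓝 z] fun _ ↦ 0 := by
        filter_upwards [(isOpen_lt continuous_norm continuous_const).mem_nhds hz] with y hy
        exact hM0 ρ hρ y (Or.inl hy)
      exact continuousAt_const.congr_of_eventuallyEq hev
    · have hz0 : z ≠ 0 := by
        rintro rfl
        simp at hz
        linarith
      have h1c : ContinuousAt (fun z : E3 ↦ deriv χ (‖z‖ / ρ) / ρ) z :=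
        (((hχ.continuous_deriv (by simp)).comp (continuous_norm.div_const ρ)).div_const ρ).continuousAt
      have h2c : ContinuousAt (fun z : E3 ↦ -A / ‖z‖ ^ 2) z :=
        continuousAt_const.div ((continuous_norm.pow 2).continuousAt)
          (pow_ne_zero 2 (norm_ne_zero_iff.2 hz0))
      exact h1c.mul h2c
  have hMint : ∀ ρ : ℝ, R₂ < ρ → Integrable (M ρ) (volume : Measure E3) := by
    intro ρ hρ
    refine (hMc ρ hρ).integrable_of_hasCompactSupport
      (HasCompactSupport.intro' (isCompact_closedBall (0 : E3) (2 * ρ)) isClosed_closedBall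
        fun z hz ↦ hM0 ρ hρ z (Or.inr ?_))
    rw [mem_closedBall_zero_iff, not_le] at hz
    exact hz
  have hFint : ∀ ρ : ℝ, R₂ < ρ → IntegrableOn (F ρ) {z : E3 | R₂ < ‖z‖} volume := by
    intro ρ hρ
    have hρ0 : 0 < ρ := by linarith
    -- integrable on the compact annulus `R₂ ≤ ‖z‖ ≤ 2ρ`, zero on the rest
    set K : Set E3 := {z | R₂ ≤ ‖z‖ ∧ ‖z‖ ≤ 2 * ρ} with hK
    have hKc : IsCompact K := by
      have : K = closedBall (0 : E3) (2 * ρ) ∩ {z | R₂ ≤ ‖z‖} := by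
        ext z
        simp only [hK, mem_setOf_eq, mem_inter_iff, mem_closedBall_zero_iff]
        tauto
      rw [this]
      exact (isCompact_closedBall _ _).inter_right (isClosed_le continuous_const continuous_norm)
    have hKsub : K ⊆ {z | e.R < ‖z‖} := fun z hz ↦ hRR₂.trans_le hz.1
    have hIK : IntegrableOn (F ρ) K volume := ((hFc ρ hρ0).mono hKsub).integrableOn_compact hKc
    have hs : {z : E3 | R₂ < ‖z‖} ⊆ K ∪ {z : E3 | 2 * ρ < ‖z‖} := by
      intro z hz
      by_cases h : ‖z‖ ≤ 2 * ρ
      · exact Or.inl ⟨le_of_lt hz, h⟩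
      · exact Or.inr (not_le.1 h)
    refine IntegrableOn.mono_set ?_ hs
    refine hIK.union ?_
    refine (integrableOn_zero).congr_fun (fun z hz ↦ (hF0 ρ hρ z (Or.inr hz)).symm)
      (isOpen_lt continuous_const continuous_norm).measurableSet
  -- (8) the chart integral: `∫ F_ρ = 4πA + ∫ (F_ρ − M_ρ)` with the error bound
  have hsplit : ∀ {η : ℝ}, 0 < η → ∀ {ρ₀ : ℝ}, (∀ z : E3, ρ₀ ≤ ‖z‖ → ∀ k l,
      |(H z)⁻¹ k l * dens z - (1 : Matrix (Fin 3) (Fin 3) ℝ) k l| ≤ η) →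
      ∀ ρ : ℝ, R₂ < ρ → ρ₀ ≤ ρ →
        |(∫ z in {z : E3 | R₂ < ‖z‖}, F ρ z) - 4 * Real.pi * A| ≤
          (32 * Real.pi / 3) * (9 * η * CV * C₁ + 3 * Cω * C₁ / ρ) := by
    intro η hη ρ₀ hW ρ hρ hρ₀
    have hρ0 : 0 < ρ := by linarith
    have hs : MeasurableSet {z : E3 | R₂ < ‖z‖} :=
      (isOpen_lt continuous_const continuous_norm).measurableSet
    -- `∫_{R₂ < ‖z‖} M_ρ = ∫ M_ρ = 4πA`
    have hMI : ∫ z in {z : E3 | R₂ < ‖z‖}, M ρ z = 4 * Real.pi * A := by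
      rw [setIntegral_eq_integral_of_forall_compl_eq_zero fun z hz ↦ hM0 ρ hρ z (Or.inl ?_)]
      · exact integral_radialMainTerm hχ h1 h2 hρ0 A
      · simp only [mem_setOf_eq, not_lt] at hz
        exact lt_of_le_of_lt hz hρ
    have hEI : (∫ z in {z : E3 | R₂ < ‖z‖}, F ρ z) - 4 * Real.pi * A =
        ∫ z in {z : E3 | R₂ < ‖z‖}, (F ρ z - M ρ z) := by
      rw [integral_sub (hFint ρ hρ) (hMint ρ hρ).integrableOn, hMI]
    rw [hEI]
    -- the error is supported in the ball of radius `2ρ` and bounded there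
    set s' : Set E3 := {z : E3 | R₂ < ‖z‖} ∩ closedBall 0 (2 * ρ) with hs'
    have hs'm : MeasurableSet s' := hs.inter measurableSet_closedBall
    have hzero : ∀ z ∈ {z : E3 | R₂ < ‖z‖} \ s', F ρ z - M ρ z = 0 := by
      intro z hz
      have hz2 : 2 * ρ < ‖z‖ := by
        have : z ∉ closedBall (0 : E3) (2 * ρ) := fun h ↦ hz.2 ⟨hz.1, h⟩
        rwa [mem_closedBall_zero_iff, not_le] at this
      rw [hF0 ρ hρ z (Or.inr hz2), hM0 ρ hρ z (Or.inr hz2), sub_zero]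
    rw [setIntegral_eq_of_subset_of_forall_sdiff_eq_zero hs inter_subset_left hzero]
    have hfin : volume s' < ⊤ :=
      (measure_mono inter_subset_right).trans_lt (isCompact_closedBall _ _).measure_lt_top
    have hbound : ∀ z ∈ s', ‖F ρ z - M ρ z‖ ≤ (9 * η * CV * C₁ / ρ ^ 2 + 3 * Cω * C₁ / ρ ^ 3) / ρ :=
      fun z hz ↦ by
        rw [Real.norm_eq_abs]
        exact hErr hη hW ρ hρ hρ₀ z hz.1
    have hI := norm_setIntegral_le_of_norm_le_const hfin hbound
    rw [Real.norm_eq_abs] at hI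
    refine hI.trans ?_
    have hvol : (volume : Measure E3).real s' ≤ (2 * ρ) ^ 3 * (Real.pi * 4 / 3) := by
      have h1 : (volume : Measure E3).real s' ≤ (volume : Measure E3).real (closedBall 0 (2 * ρ)) :=
        measureReal_mono inter_subset_right (isCompact_closedBall _ _).measure_lt_top.ne
      refine h1.trans (le_of_eq ?_)
      rw [measureReal_def, EuclideanSpace.volume_closedBall_fin_three, ENNReal.toReal_mul,
        ← ENNReal.ofReal_pow (by positivity), ENNReal.toReal_ofReal (by positivity),
        ENNReal.toReal_ofReal (by positivity)]
    have hnn : 0 ≤ (9 * η * CV * C₁ / ρ ^ 2 + 3 * Cω * C₁ / ρ ^ 3) / ρ := by positivity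
    calc (9 * η * CV * C₁ / ρ ^ 2 + 3 * Cω * C₁ / ρ ^ 3) / ρ * (volume : Measure E3).real s'
        ≤ (9 * η * CV * C₁ / ρ ^ 2 + 3 * Cω * C₁ / ρ ^ 3) / ρ * ((2 * ρ) ^ 3 * (Real.pi * 4 / 3)) :=
          mul_le_mul_of_nonneg_left hvol hnn
      _ = (32 * Real.pi / 3) * (9 * η * CV * C₁ + 3 * Cω * C₁ / ρ) := by
          field_simp
          ring
  -- (9) conclusion: `|L + 4πA| ≤ ε` for every `ε > 0`
  have hfinal : ∀ ε : ℝ, 0 < ε → |L + 4 * Real.pi * A| ≤ ε := by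
    intro ε hε
    -- the left-hand side is eventually `ε/2`-close to `L`
    have hev1 : ∀ᶠ ρ : ℝ in atTop, |∫ x, χ (‖e.coord x‖ / ρ) * D.metric.dalembertian v x ∂μ - L| ≤ ε / 2 := by
      have := (Metric.tendsto_nhds.1 hLHS) (ε / 2) (by positivity)
      filter_upwards [this] with ρ hρ
      rw [Real.dist_eq] at hρ
      exact hρ.le
    -- the error is eventually `≤ ε/2`
    set η : ℝ := ε / (4 * ((32 * Real.pi / 3) * (9 * CV * C₁) + 1)) with hηdef
    have hη : 0 < η := by positivity
    obtain ⟨ρ₀, hW⟩ := e.exists_radius_abs_gramInvSqrtDet_sub_one_le D hα hAF hη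
    have hev2 : ∀ᶠ ρ : ℝ in atTop, (32 * Real.pi / 3) * (9 * η * CV * C₁ + 3 * Cω * C₁ / ρ) ≤ ε / 2 := by
      have ht : Tendsto (fun ρ : ℝ ↦ (32 * Real.pi / 3) * (9 * η * CV * C₁ + 3 * Cω * C₁ / ρ)) atTop
          (𝓝 ((32 * Real.pi / 3) * (9 * η * CV * C₁ + 0))) := by
        refine Tendsto.const_mul _ (tendsto_const_nhds.add ?_)
        simpa using (tendsto_const_nhds (x := 3 * Cω * C₁)).div_atTop tendsto_id
      have hlt : (32 * Real.pi / 3) * (9 * η * CV * C₁ + 0) < ε / 2 := by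
        rw [add_zero, hηdef]
        have hpos : 0 < (32 * Real.pi / 3) * (9 * CV * C₁) + 1 := by positivity
        have h1 : (32 * Real.pi / 3) * (9 * (ε / (4 * ((32 * Real.pi / 3) * (9 * CV * C₁) + 1))) *
            CV * C₁) = (ε / 4) * (((32 * Real.pi / 3) * (9 * CV * C₁)) /
              ((32 * Real.pi / 3) * (9 * CV * C₁) + 1)) := by
          field_simp
        rw [h1]
        have h2 : ((32 * Real.pi / 3) * (9 * CV * C₁)) / ((32 * Real.pi / 3) * (9 * CV * C₁) + 1) < 1 :=
          (div_lt_one hpos).2 (by linarith)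
        have h3 : 0 ≤ ((32 * Real.pi / 3) * (9 * CV * C₁)) / ((32 * Real.pi / 3) * (9 * CV * C₁) + 1) :=
          by positivity
        nlinarith
      exact (ht.eventually (Iic_mem_nhds hlt)).mono fun ρ hρ ↦ hρ
    obtain ⟨ρ, hρ1, hρ2, hρR, hρ₀⟩ := (hev1.and (hev2.and ((eventually_gt_atTop R₂).and
      (eventually_ge_atTop ρ₀)))).exists
    have hG := hGreen ρ hρR
    rw [hRHS ρ hρR] at hG
    have hS := hsplit hη hW ρ hρR hρ₀
    -- assemble
    have h3 : |∫ x, χ (‖e.coord x‖ / ρ) * D.metric.dalembertian v x ∂μ + 4 * Real.pi * A| ≤ ε / 2 := by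
      rw [hG, show -(∫ z in {z : E3 | R₂ < ‖z‖}, F ρ z) + 4 * Real.pi * A =
        -((∫ z in {z : E3 | R₂ < ‖z‖}, F ρ z) - 4 * Real.pi * A) by ring, abs_neg]
      exact hS.trans hρ2
    set I : ℝ := ∫ x, χ (‖e.coord x‖ / ρ) * D.metric.dalembertian v x ∂μ with hI
    calc |L + 4 * Real.pi * A|
        = |(L - I) + (I + 4 * Real.pi * A)| := by
          congr 1
          ring
      _ ≤ |L - I| + |I + 4 * Real.pi * A| := abs_add_le _ _
      _ ≤ ε / 2 + ε / 2 := add_le_add (by rw [abs_sub_comm]; exact hρ1) h3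
      _ = ε := by ring
  -- hence `L = −4πA`
  have h0 : |L + 4 * Real.pi * A| ≤ 0 := by
    refine le_of_forall_pos_le_add fun ε hε ↦ ?_
    rw [zero_add]
    exact hfinal ε hε
  have h0' : L + 4 * Real.pi * A = 0 := abs_nonpos_iff.1 h0
  linarith

/-- **The flux formula with the expansion in `iteratedFDeriv` form**: if
`‖D^m(v ∘ Φ − (c + A/r))(z)‖ = O(‖z‖^{−2−m})` for `m ≤ 2` (the form of Schoen–Yau's
(3.17)–(3.18) used by `exists_conformal_negativeMass_of_massZero_of_ellipticCore`; only `m = 1`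
is consumed), then `∫_X Δ_h v dV_h = −4πA`. [cite: SchoenYauPMT1979, Lemma 3.2 (3.16)] -/
theorem integral_dalembertian_eq_of_expansion' {α : ℝ} (hα : 0 < α)
    (hAF : e.IsMetricAsymptoticallyFlat D α) (hsole : e.IsSoleEnd) {v : X → ℝ}
    (hv : ContMDiff (𝓡 3) 𝓘(ℝ, ℝ) 2 v)
    (hΔ : Integrable (D.metric.dalembertian v) (riemannianMeasure D.h)) {c A : ℝ}
    (hexp : ∀ m : ℕ, m ≤ 2 →
      (fun x : E3 ↦ ‖iteratedFDeriv ℝ m (fun y ↦ endValue e v y - (c + A / ‖y‖)) x‖)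
        =O[cobounded E3] fun x ↦ ‖x‖ ^ (-2 - m : ℝ)) :
    ∫ x, D.metric.dalembertian v x ∂riemannianMeasure D.h = -(4 * Real.pi * A) := by
  refine e.integral_dalembertian_eq_of_expansion D hα hAF hsole hv hΔ (c := c) (A := A) ?_
  have h := hexp 1 one_le_two
  refine (h.congr_left fun x ↦ ?_).congr_right fun x ↦ ?_
  · rw [← norm_iteratedFDeriv_fderiv, norm_iteratedFDeriv_zero]
  · norm_num

end AFEnd

end Literature.Geometry.Lorentzian

end
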